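import Literature.MathematicalPhysics.QuantumFieldTheory.Balaban1983to89.B4ThmBoxPairEtaNoCollar

/-!
# `Balaban1983to89.B4ThmPrintedMonotone` — [Balaban1983RegularityDecay] THEOREM p. 573 / (1.8): the typed statements
# `ThmPrinted`, `ThmPrintedNN`, `Claim18Printed` are MONOTONE IN THE SIDE CONDITION `regular`; p17's collared box-pair
# theorem as a corollary of r04's collar-free one; a witness that the collar-free family is strictly larger

statement-level skeleton of published theorems with citation tags; proofs where landed; nothing here is a claim about the Yang–Mills mass gap

CITATION HEADER.  T. Bałaban, *Regularity and decay of lattice Green's functions*, Commun. Math. Phys. **89** (1983)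
571–597, doi:10.1007/bf01214744 [Balaban1983RegularityDecay] (cell paper B4; held text
`paper:balaban1983-cmp89-regularity-decay`, journal page = PDF page + 570; p. 573 Theorem (1.9)–(1.12) and (1.8),
(1.7) p. 572).  Unit `lit-balaban-r01` gen 12 (B4 fold owner; HOME `run/shared/lean/pub/lit-balaban/`), SKELETON row
**B4.Thm@573** (cells only).  Imports r04 g15's `B4ThmBoxPairEtaNoCollar` (`boxPairFamNC`, `KmodNC`,
`thmPrintedNN_boxPairFamNC`, `regular_of_boxPairFam_regular`; → p17's `B4ThmBoxPairEta`: `BoxPairInst`, `boxPairFam`;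
→ b04's `B4.EtaSetting` / `Ineq19_110` / `Ineq111_112` / `ThmPrinted` / `Claim18Printed` and pv17's `ThmPrintedNN`).
Theorems only; no new definition, no `Prop` fact, no `sorry`.  v1.1 (gen 13): module docstring only — the «WHAT IS PRINTED»
paragraph re-sourced to pp. 572–573 (referee-1 gen 64 cosmetic F1); declarations byte-identical to v1.0 (p330841).

WHAT IS PRINTED (pp. 572–573).  The Theorem (p. 573) is stated «for e sufficiently small and for an arbitrary
function f : Ω → R^N» about the operators of (1.6), which p. 572 considers «under the assumption that the vector field
A is regular on Ω in the sense that» (1.7) (|(∂^η_μ A_ν)(x)| ≤ c e^{β−1}, x ∈ Ω, β > 0; p. 573 l. 1 «and c is some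
universal constant»), on regions Ω subject to the standing sentence of p. 572 «We consider subsets Ω which are unions
of big blocks»; (1.8) p. 573 «for e sufficiently small and for a regular vector field A».  (v1.1 locator repair,
referee-1 gen 64: v1.0 wrote here «Ω being a sum of big blocks» as if quoted from the Theorem — that phrase is p. 574
l. 3 «Λ being a sum of big blocks», in the statement of Proposition 2.3 of [1], about Λ; the Theorem's region
hypothesis is the p. 572 sentence just quoted.)  In the cell's typed forms these printed hypotheses are the fields
`regular`, `bigBlocks` of b04's `EtaSetting`, and they occur ONLY as antecedents.

WHAT THIS MODULE PROVES (all in full).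
* §1 (bookkeeping on b04's typed forms) `ineq19_110_update_regular`, `ineq111_112_update_regular`,
  `lower18_update_regular` — the conclusions (1.9)–(1.12), (1.8) of a setting do not see the field `regular`
  (`Iff.rfl` / `rfl` on the one-field structure update `{ S with regular := r }`); hence
  **`thmPrintedNN_of_regular_imp`**, `thmPrinted_of_regular_imp`, `claim18Printed_of_regular_imp`: replacing
  `regular` instance-wise by any STRONGER predicate preserves `ThmPrintedNN` / `ThmPrinted` / `Claim18Printed`.
* §2 `boxPairFam_eq_update` (`rfl`): p17's collared family IS r04's collar-free family with p17's `regular` put back;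
  **`thmPrintedNN_boxPairFam_of_noCollar`**: for every modulus `K`, `ThmPrintedNN (boxPairFamNC … K) →
  ThmPrintedNN (boxPairFam … K)`; `thmPrintedNN_boxPairFam'`: p17's statement re-derived at the modulus `KmodNC` from
  r04's `thmPrintedNN_boxPairFamNC`.
* §3 **`hypotheses_met_noCollar_ramp`**: for `c > 0`, `K ≥ 2` and every threshold `e₁ > 0` an instance admitted by
  `boxPairFamNC` ((1.7), big blocks, `0 < e ≤ e₁`) whose field is the linear ramp `A_c(w)_ν = s·w₀`,
  `s = c e₁^{β−1}/(ℓ+1)`, which VIOLATES p17's collar clause (`A_c(e₀) = s ≠ 0 = A_c(0)` at a collar site of `Ω₀`):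
  the collar-free family is strictly larger, so the cell's closure of GAPS G-B4-p17-02 (ROWS-B4 v1.82) is not a
  relabelling.
HONEST SCOPE.  Pure bookkeeping on typed statements already in the tree; the analytic content is r04's
(`B4ThmBoxPairEtaNoCollar` and its imports) and p17's.  `d`, `ℓ` arbitrary in §1–§3 except where r04's theorem is
invoked (`1 ≤ d`, `1 ≤ ℓ`, `0 < a₋`, `0 ≤ c`, `0 < β`).
-/

namespace Literature.MathematicalPhysics.QuantumFieldTheory.Balaban1983to89.B4ThmPrintedMonotone

open Literature.MathematicalPhysics.QuantumFieldTheory.Balaban1983to89.B4 (EtaSetting Ineq19_110 Ineq111_112 ThmPrinted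
  Claim18Printed)
open Literature.MathematicalPhysics.QuantumFieldTheory.Balaban1983to89.B4Ineq111ZeroNestEta (ThmPrintedNN)
open Literature.MathematicalPhysics.QuantumFieldTheory.Balaban1983to89.B4Reflection242 (boxDom mem_boxDom)
open Literature.MathematicalPhysics.QuantumFieldTheory.Balaban1983to89.B4GaugeCovariance
open Literature.MathematicalPhysics.QuantumFieldTheory.Balaban1983to89.B4Lower18Regular (e1 e1_apply_self e1_apply_ne)
open Literature.MathematicalPhysics.QuantumFieldTheory.Balaban1983to89.B4Lemma22ReduceZero (Box)
open Literature.MathematicalPhysics.QuantumFieldTheory.Balaban1983to89.B4ThmBoxPairEta (BoxPairInst boxPairFam)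
open Literature.MathematicalPhysics.QuantumFieldTheory.Balaban1983to89.B4ThmBoxPairEtaNoCollar (boxPairFamNC KmodNC
  thmPrintedNN_boxPairFamNC regular_of_boxPairFam_regular)
open scoped Matrix

noncomputable section

/-! ## §1. The typed statements are monotone in the side condition `regular` -/

/-- the typed inequalities (1.9)–(1.10) of a setting do not see the field `regular`.
[cite: Balaban1983RegularityDecay, (1.9)–(1.10) p.573, dictionary] -/
theorem ineq19_110_update_regular (S : EtaSetting) (r : Prop) (α δ₀ c₀ R₀ : ℝ) :
    Ineq19_110 { S with regular := r } α δ₀ c₀ R₀ ↔ Ineq19_110 S α δ₀ c₀ R₀ :=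
  Iff.rfl

/-- the typed inequalities (1.11)–(1.12) of a setting do not see the field `regular`.
[cite: Balaban1983RegularityDecay, (1.11)–(1.12) p.573, dictionary] -/
theorem ineq111_112_update_regular (S : EtaSetting) (r : Prop) (α δ₀ c₀ R₀ : ℝ) :
    Ineq111_112 { S with regular := r } α δ₀ c₀ R₀ ↔ Ineq111_112 S α δ₀ c₀ R₀ :=
  Iff.rfl

/-- the typed lower bound (1.8) of a setting does not see the field `regular`.
[cite: Balaban1983RegularityDecay, (1.8) p.573, dictionary] -/
theorem lower18_update_regular (S : EtaSetting) (r : Prop) (γ : ℝ) :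
    ({ S with regular := r } : EtaSetting).lower18 γ = S.lower18 γ :=
  rfl

/-- **`ThmPrintedNN` IS MONOTONE IN THE SIDE CONDITION**: strengthening `regular` instance-wise (every other field
unchanged) preserves pv17's typed Theorem (`0 ≤ α < 1`). [cite: Balaban1983RegularityDecay, Theorem p.573, dictionary] -/
theorem thmPrintedNN_of_regular_imp {I : Type} (fam : I → EtaSetting) (r : I → Prop)
    (hr : ∀ i, r i → (fam i).regular) (h : ThmPrintedNN fam) :
    ThmPrintedNN (fun i => { fam i with regular := r i }) := by
  intro α hα0 hα1
  obtain ⟨δ₀, c₀, R₀, e₁, hδ₀, hc₀, hR₀, he₁, H⟩ := h α hα0 hα1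
  refine ⟨δ₀, c₀, R₀, e₁, hδ₀, hc₀, hR₀, he₁, fun i hreg hbig he hle => ?_⟩
  rw [ineq19_110_update_regular, ineq111_112_update_regular]
  exact H i (hr i hreg) hbig he hle

/-- **b04's literal `ThmPrinted` (every `α < 1`) IS MONOTONE IN THE SIDE CONDITION** likewise.
[cite: Balaban1983RegularityDecay, Theorem p.573, dictionary] -/
theorem thmPrinted_of_regular_imp {I : Type} (fam : I → EtaSetting) (r : I → Prop)
    (hr : ∀ i, r i → (fam i).regular) (h : ThmPrinted fam) :
    ThmPrinted (fun i => { fam i with regular := r i }) := by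
  intro α hα1
  obtain ⟨δ₀, c₀, R₀, e₁, hδ₀, hc₀, hR₀, he₁, H⟩ := h α hα1
  refine ⟨δ₀, c₀, R₀, e₁, hδ₀, hc₀, hR₀, he₁, fun i hreg hbig he hle => ?_⟩
  rw [ineq19_110_update_regular, ineq111_112_update_regular]
  exact H i (hr i hreg) hbig he hle

/-- **`Claim18Printed` ((1.8) typed) IS MONOTONE IN THE SIDE CONDITION** likewise.
[cite: Balaban1983RegularityDecay, (1.8) p.573, dictionary] -/
theorem claim18Printed_of_regular_imp {I : Type} (fam : I → EtaSetting) (r : I → Prop)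
    (hr : ∀ i, r i → (fam i).regular) (h : Claim18Printed fam) :
    Claim18Printed (fun i => { fam i with regular := r i }) := by
  obtain ⟨γ₀, e₁, hγ₀, he₁, H⟩ := h
  exact ⟨γ₀, e₁, hγ₀, he₁, fun i hreg he hle => H i (hr i hreg) he hle⟩

/-! ## §2. p17's collared box-pair family as a corollary of r04's collar-free family -/

variable {ι : Type} [Fintype ι] [DecidableEq ι]

/-- p17's family IS r04's collar-free family with p17's `regular` ((1.7) AND the two collar clauses) put back — every
other field agrees definitionally. [cite: Balaban1983RegularityDecay, Theorem p.573, dictionary] -/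
theorem boxPairFam_eq_update (F : OrthFlow ι) (d ℓ : ℕ) (amin aplus m2plus creg β : ℝ) (K : ℕ)
    (i : BoxPairInst d ℓ amin aplus m2plus) :
    boxPairFam F d ℓ amin aplus m2plus creg β K i =
      { boxPairFamNC F d ℓ amin aplus m2plus creg β K i with
        regular := (boxPairFam F d ℓ amin aplus m2plus creg β K i).regular } :=
  rfl

/-- **p17's COLLARED THEOREM FROM r04's COLLAR-FREE ONE**, for every modulus `K`: `ThmPrintedNN (boxPairFamNC … K)`
implies `ThmPrintedNN (boxPairFam … K)` — the old family only asks more of the instance.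
[cite: Balaban1983RegularityDecay, Theorem (1.9)–(1.12) p.573] -/
theorem thmPrintedNN_boxPairFam_of_noCollar (F : OrthFlow ι) (d ℓ : ℕ) (amin aplus m2plus creg β : ℝ) (K : ℕ)
    (h : ThmPrintedNN (boxPairFamNC F d ℓ amin aplus m2plus creg β K)) :
    ThmPrintedNN (boxPairFam F d ℓ amin aplus m2plus creg β K) := by
  have e : boxPairFam F d ℓ amin aplus m2plus creg β K
      = fun i => { boxPairFamNC F d ℓ amin aplus m2plus creg β K i with
          regular := (boxPairFam F d ℓ amin aplus m2plus creg β K i).regular } :=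
    funext fun i => boxPairFam_eq_update F d ℓ amin aplus m2plus creg β K i
  rw [e]
  exact thmPrintedNN_of_regular_imp _ _
    (fun i hi => regular_of_boxPairFam_regular F d ℓ amin aplus m2plus creg β K i hi) h

/-- **THEOREM p. 573 (1.9)–(1.12) ON p17's COLLARED BOX-PAIR FAMILY, RE-DERIVED at the modulus `KmodNC`** from r04's
collar-free theorem (p17's own `B4ThmBoxPairEta.thmPrintedNN_boxPairFam` has it at `Kmod`).
[cite: Balaban1983RegularityDecay, Theorem (1.9)–(1.12) p.573] -/
theorem thmPrintedNN_boxPairFam' (F : OrthFlow ι) {ℓ₁ : ℝ} (hℓ₁ : 0 ≤ ℓ₁)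
    (hLip : ∀ t (v : ι → ℝ), ((F.U t - 1) *ᵥ v) ⬝ᵥ ((F.U t - 1) *ᵥ v) ≤ (ℓ₁ * t) ^ 2 * (v ⬝ᵥ v))
    (d ℓ : ℕ) (hd : 1 ≤ d) (hℓ : 1 ≤ ℓ) (amin aplus m2plus : ℝ) (ha : 0 < amin) (creg β : ℝ) (hcreg : 0 ≤ creg)
    (hβ : 0 < β) :
    ThmPrintedNN (boxPairFam F d ℓ amin aplus m2plus creg β (KmodNC F hℓ₁ hLip d ℓ hd hℓ amin aplus m2plus ha)) :=
  thmPrintedNN_boxPairFam_of_noCollar F d ℓ amin aplus m2plus creg β _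
    (thmPrintedNN_boxPairFamNC F hℓ₁ hLip d ℓ hd hℓ amin aplus m2plus ha creg β hcreg hβ)

/-! ## §3. The collar-free family is strictly larger -/

/-- **A WITNESS THAT THE COLLAR-FREE FAMILY IS STRICTLY LARGER**: for `c > 0`, `K ≥ 2` (as for `KmodNC ≥ 16`) and every
threshold `e₁ > 0` there is an instance admitted by r04's `boxPairFamNC` (`regular` = (1.7), `bigBlocks`, `0 < e ≤ e₁`)
that VIOLATES p17's collar clause — the linear ramp `A_c(w)_ν = s·w₀`, `s = c·e₁^{β−1}/(ℓ+1)`, on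
`Ω = Π[0,nK) ⊂ Ω₀ = Π[0,2nK)` at scale `k = 1`, coupling `e₁`: it satisfies (1.7) (with equality along `μ = 0`) and
`A_c(e₀) = s ≠ 0 = A_c(0)` at the collar site `e₀` of `Ω₀`. [cite: Balaban1983RegularityDecay, (1.7) p.572, dictionary] -/
theorem hypotheses_met_noCollar_ramp (F : OrthFlow ι) (d ℓ : ℕ) {amin aplus m2plus : ℝ} (hap : amin ≤ aplus)
    (hm : 0 ≤ m2plus) (creg β : ℝ) (hcreg : 0 < creg) (K : ℕ) (hK : 2 ≤ K) (e₁ : ℝ) (he₁ : 0 < e₁) :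
    ∃ i : BoxPairInst d ℓ amin aplus m2plus,
      (boxPairFamNC F d ℓ amin aplus m2plus creg β K i).regular ∧
      (boxPairFamNC F d ℓ amin aplus m2plus creg β K i).bigBlocks ∧
      0 < (boxPairFamNC F d ℓ amin aplus m2plus creg β K i).e ∧
      (boxPairFamNC F d ℓ amin aplus m2plus creg β K i).e ≤ e₁ ∧
      ¬ (boxPairFam F d ℓ amin aplus m2plus creg β K i).regular := by
  have hK1 : 1 ≤ K := le_trans (by norm_num) hK
  have hn1 : 1 ≤ (ℓ + 1) ^ 1 := Nat.one_le_pow 1 (ℓ + 1) (Nat.succ_pos ℓ)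
  have h2 : 2 ≤ (ℓ + 1) ^ 1 * K := le_trans (by norm_num) (Nat.mul_le_mul hn1 hK)
  have h4 : 2 ≤ (ℓ + 1) ^ 1 * (2 * K) := le_trans h2 (Nat.mul_le_mul_left _ (by omega))
  set s : ℝ := creg * e₁ ^ (β - 1) / ((ℓ + 1) ^ 1 : ℕ) with hs
  have hs0 : 0 < s := by rw [hs]; positivity
  refine ⟨⟨1, le_rfl, fun _ => 2 * K, fun _ => K, fun _ => 0, fun _ => by omega, fun _ => hK1, amin, 0, le_rfl, hap,
    le_rfl, hm, fun w _ => s * (w 0 : ℝ), e₁⟩, ?_, ⟨fun _ => Dvd.intro_left 2 rfl, fun _ => dvd_rfl⟩, he₁, le_rfl, ?_⟩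
  · intro x _ μ ν
    change |s * (((x + e1 μ) 0 : ℤ) : ℝ) - s * ((x 0 : ℤ) : ℝ)| ≤ creg * e₁ ^ (β - 1) / ((ℓ + 1) ^ 1 : ℕ)
    rw [← mul_sub, abs_mul, abs_of_pos hs0, ← hs]
    have h01 : |(((x + e1 μ) 0 : ℤ) : ℝ) - ((x 0 : ℤ) : ℝ)| ≤ 1 := by
      rw [Pi.add_apply, Int.cast_add, add_sub_cancel_left]
      by_cases h0 : (0 : Fin (d + 1)) = μ
      · subst h0
        rw [e1_apply_self]
        simp
      · rw [e1_apply_ne h0]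
        simp
    calc s * |(((x + e1 μ) 0 : ℤ) : ℝ) - ((x 0 : ℤ) : ℝ)| ≤ s * 1 := mul_le_mul_of_nonneg_left h01 hs0.le
      _ = s := mul_one s
  · intro hreg
    dsimp only [boxPairFam] at hreg
    obtain ⟨-, hcol0, -⟩ := hreg
    have hw : (e1 0 : Fin (d + 1) → ℤ) ∈ Box d ℓ 1 (fun _ => 2 * K) := by
      refine mem_boxDom.mpr fun j => ?_
      dsimp only
      by_cases hj : j = 0
      · subst hj
        rw [e1_apply_self]
        exact ⟨zero_le_one, by exact_mod_cast lt_of_lt_of_le (by norm_num) h4⟩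
      · rw [e1_apply_ne hj]
        exact ⟨le_rfl, by exact_mod_cast lt_of_lt_of_le (by norm_num) h4⟩
    have hlt : (e1 0 : Fin (d + 1) → ℤ) 0 < (((ℓ + 1) ^ 1 : ℕ) : ℤ) * K := by
      rw [e1_apply_self]
      exact_mod_cast lt_of_lt_of_le (by norm_num) h2
    have h := hcol0 _ hw ⟨0, Or.inl hlt⟩ 0
    change s * (((e1 0 : Fin (d + 1) → ℤ) 0 : ℤ) : ℝ) = s * (((0 : Fin (d + 1) → ℤ) 0 : ℤ) : ℝ) at h
    rw [e1_apply_self, Pi.zero_apply, Int.cast_one, Int.cast_zero, mul_one, mul_zero] at h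
    exact hs0.ne' h

end

end Literature.MathematicalPhysics.QuantumFieldTheory.Balaban1983to89.B4ThmPrintedMonotone
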